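import Mathlib.Probability.Distributions.Bernoulli
import Mathlib.Probability.ProductMeasure
import Mathlib.MeasureTheory.Measure.Prod
import Mathlib.Analysis.SpecialFunctions.Trigonometric.Basic
import Literature.Probability.LatticeModels.CellGridSaddleSymmetry
import HarnessLib

/-!
# The corner-fugacity measure on cell colourings of `ℤ²` and its Izergin–Korepin specialisation

Topic: `Literature/Probability/LatticeModels` (definition request `defn-CornerFugacityMeasure`,
wanted by route `CardyIKTransport` of `CriticalPhenomena/CardyFormulaZ2`, items
`IKLinearTransport` / `CornerLineDescent` / `IKBoxCrossing`, cards `corner-fugacity-plane`,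
`ik-isotropic-cle6-transport`).

## The model

Configurations are those of the companion file `CellGridSaddlePercolation.lean`:
`CellConfig = (Site 2 → Bool) × (Site 2 → Bool)`, a black/white colouring `σ` of the cells `Site 2`
of `ℤ²` and a coin `κ w` at every grid vertex (face) `w`, the four cells around `w` being
`cellFace w = {w, w + e₀, w + e₁, w + 1}` with `blackCount σ w` black ones.  The vertex `w` is an
**odd face** of `σ` (`IsOddFace`) — a *corner*, i.e. turning vertex, of the domain walls between
black and white — iff `blackCount σ w` is odd; vacancy (`0`/`4` black), straight (two edge-adjacent
black) and checkerboard faces (`IsCheckerboard`, resolved by the coin) are not.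

For a corner fugacity `t ≥ 0` (`ℝ≥0`), a coin bias `b ∈ [0, 1]` (`unitInterval`), a finite set
of cells `Λ` and a boundary colouring `ξ`, the **corner-fugacity measure**
`cornerFugacityMeasure t b Λ ξ : Measure CellConfig` is the product of

* the finite-volume Gibbs distribution `cornerGibbsMeasure t (verticesMeeting Λ) Λ ξ` on
  colourings: `σ = ξ` off `Λ`, and `σ` has probability proportional to
  `t ^ #{grid vertices meeting Λ that are odd faces of σ}` (at `t = 0`, by `0 ^ 0 = 1`, the
  uniform measure on the corner-free colourings compatible with `ξ`; the zero measure if there is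
  none) — the Gibbs distribution in `Λ` with boundary condition `ξ` of the plaquette interaction
  `-log t · 1{w is an odd face}` (Friedli–Velenik 2017, Ch. 6, written out on a finite state space);
* the product Bernoulli measure `coinMeasure b`: coins i.i.d., `κ w = true` with probability `b`,
  independent of `σ`.

The **free** variant `freeCornerFugacityMeasure t b Λ` counts only the faces whose four cells lie in
`Λ` (`innerVertices Λ`) and fixes `σ = white` off `Λ`; it has no boundary term, which is the form
needed for exact self-duality at `b = ½` and at the freezing point `t = 0` (uniform measure on the
corner-free = XOR colourings `σ (x, y) = a x ⊕ b y` of `Λ`; with a *white* boundary condition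
instead, `t = 0` would force `σ ≡ white`).  API: probability-measure instances, the Gibbs form
`cornerGibbsMeasure_apply_singleton`, the boundary condition `ae_eqOn_cornerGibbsMeasure`, the
`t = 1` (uniform) and `t = 0` (no odd face a.s.) members, the colour-flip
(`cornerGibbsMeasure_map_flip`, `cornerFugacityMeasure_map_swap`) and coin-flip
(`coinMeasure_map_flip`) covariances.

## The Izergin–Korepin (dilute `A₂⁽²⁾`, `n = 1`) specialisation

In the colouring representation of the `n = 1` dilute `A₂⁽²⁾` loop model on the square lattice at
crossing parameter `λ = π/3` (loops = domain walls between black and white cells; the nine face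
configurations of Morin-Duchesne–Klümper–Pearce, arXiv:2211.12379, §3.1, with weights
`ρ₁ = ρ₆ = ρ₇ = (4/3) sin² u` (vacancy, two straight tiles), `ρ₂ = … = ρ₅ = (2/√3) sin u` (the four
turns), `ρ₈ = (4/3) sin u sin (2π/3 - u)`, `ρ₉ = (4/3) sin u sin (u - π/3)` (the two pairings of a
checkerboard face), contractible-loop fugacity `-2 cos 4λ = 1`), dividing by `(4/3) sin² u` gives
the vertex weights (vacancy, straight, turn, pairing, other pairing) `= (1, 1, t u, b u, 1 - b u)`,

  `t u = √3 / (2 sin u)` (`ikCornerFugacity`), `b u = sin (2π/3 - u) / sin u` (`ikCoinBias`),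

with `b u + (1 - b u) = 1` identically, so the model *is* `cornerFugacityMeasure (t u) (b u)` =
`ikMeasure u` (free version `freeIKMeasure u`).  At `u = π/3`: `t = 1`, `b = 1`
(`ikCornerFugacity_pi_div_three`, `ikCoinBias_pi_div_three`) — i.i.d. fair colouring and all coins
`true`, i.e. site percolation on the triangulation with the NE–SW diagonal (arXiv:2211.12379 §3.6:
"the weight of the last tile vanishes, and the weights of the remaining eight tiles are all equal to
1"; `freeIKMeasure_pi_div_three`); at the isotropic point `u = 3λ/2 = π/2`: `(1, 1, √3/2, ½, ½)`
(`coe_ikCornerFugacity_pi_div_two`, `coe_ikCoinBias_pi_div_two`).  (Square-lattice `O(n)` vertex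
weights: Blöte–Nienhuis 1989; Nienhuis 1990; Warnaar–Nienhuis–Seaton 1992.)

## Lattice symmetries

A pair of bijections `e` (cells), `f` (faces) with `(cellFace v).image e = cellFace (f v)`
transports the corner interaction, the Gibbs distributions and both measures exactly
(`cornerGibbsMeasure_map_relabel`, `coinMeasure_map_relabel`, `cornerFugacityMeasure_map_relabel`,
`freeCornerFugacityMeasure_map_relabel`); translations (`image_cellFace_shift`) and the two
generators `CellSymmetry.rot`, `CellSymmetry.reflect` of the dihedral group of `δℤ²` about the
origin from `CellGridSaddleSymmetry.lean` (`image_cellFace_rot`, `image_cellFace_reflect`) are such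
pairs.  For a cell symmetry `s` of that file the full action `s.act` on configurations (coins
transported AND flipped when `s` exchanges the diagonal directions) maps `M(t, b)` to
`M(t, s.biasAct b)` with `biasAct b = 1 - b` for `rot` and `reflect`
(`CellSymmetry.map_act_cornerFugacityMeasure`, `CellSymmetry.map_act_freeCornerFugacityMeasure`).

## Crossing probabilities of conformal rectangles

`cellBox Ω δ` is the finite set of cells whose mesh point `δ x` lies within closed distance `1` of
`Ω` (it contains the discrete domain `meshDomain Ω δ` and is covariant, `cellBox_image_plane`).
`cornerCrossingProb t b R δ` is the probability under the FREE measure `M(t, b)` in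
`cellBox R.carrier δ` of the black crossing event `cellDomainCrossing R δ` of the conformal
rectangle `R` (companion file: G02 discretisation, saddles resolved by the coins), and
`ikCrossingProb u := cornerCrossingProb (t u) (b u)`.  The three requirements of the request:
(i) exact `D₄`-covariance at `u = π/2`: `ikCrossingProb_pi_div_two_rot`
(`ikCrossingProb (π/2) (R.map (Homeomorph.mulLeft₀ I _)) δ = ikCrossingProb (π/2) R δ`, every `R`,
every `δ`) and `ikCrossingProb_pi_div_two_reflect`, from the general `cornerCrossingProb_rot` /
`cornerCrossingProb_reflect` (`b ↦ 1 - b`); (ii) `ikCrossingProb_pi_div_three` (uniform colouring,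
coins `true`); (iii) `ikCrossingProb_mem_Icc`.  No claim about infinite-volume limits, FKG, RSW,
self-duality or criticality is made in this file (the Hex lemma is the companion's named fact
`cellCrossing_duality`).

## References

* A. Morin-Duchesne, A. Klümper, P. A. Pearce, *Critical site percolation on the triangular
  lattice: from integrability to conformal partition functions*, J. Stat. Mech. (2023) 043103,
  arXiv:2211.12379, §3.1 (face weights `ρ₁ … ρ₉`), §3.6 (`λ = u = π/3` is site percolation;
  isotropic point `u = 3λ/2`). [MorinduchesneKlumperPearce2023]
* H. W. J. Blöte, B. Nienhuis, J. Phys. A 22 (1989) 1415, §2 (the `O(n)` model on the square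
  lattice: vertex weights for vacancy / one bend / straight / two bends). [BloteNienhuis1989]
* B. Nienhuis, Int. J. Mod. Phys. B 4 (1990) 929 (integrable branches of the square-lattice `O(n)`
  model = dilute `A₂⁽²⁾`). [Nienhuis1990]
* S. O. Warnaar, B. Nienhuis, K. A. Seaton, Phys. Rev. Lett. 69 (1992) 710 (the dilute
  `A₂⁽²⁾` / Izergin–Korepin weights). [WarnaarNienhuisSeaton1992]
* S. Friedli, Y. Velenik, *Statistical mechanics of lattice systems* (2017), §3.1 and Ch. 6
  (finite-volume Gibbs distributions with boundary condition; free boundary condition).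
  [FriedliVelenik2017]

Mathlib anchors used rather than re-defined: `ProbabilityTheory.bernoulliMeasure` (`Ber(x, y, p)`),
`MeasureTheory.Measure.infinitePi` (+ `infinitePi_map_piCongrLeft`, `infinitePi_map_pi`,
`infinitePi_dirac`), `Measure.prod`, `Measure.dirac`, `Set.projIcc`, `Real.toNNReal`,
`unitInterval`, `Metric.cthickening`, `Metric.infEDist_image`, `MeasurableEquiv.piCongrLeft`; tree
anchors: `Site`, `Site.shift` (`LatticeGraph`), `meshPoint`, `meshVertices`, `meshVertices_finite`,
`meshDomain` (`DomainDiscretisation`), `CellConfig`, `cellFace`, `blackCount`, `IsCheckerboard`,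
`CellConfig.swap` (`CellGridSaddlePercolation`), `CellSymmetry` (`rot`, `reflect`, `act`, `coinAct`,
`measurable_act`, `preimage_act_cellCrossing`), `rotCell`, `cellReflect`, `cellDomainCrossing`,
`measurableSet_cellDomainCrossing` (`CellGridSaddleSymmetry`), `MarkedDomain.map`
(`ChordalCurveFamily`).  Mathlib has no Gibbs specifications and no vertex / loop models (searched
`Gibbs|vertex model|loop model|plaquette|corner`).
-/

noncomputable section

namespace Literature.Probability.LatticeModels

open MeasureTheory ProbabilityTheory Finset
open scoped ENNReal NNReal

/-! ### Odd (turning) faces of a colouring -/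

/-- `e₀ = Pi.single 0 1`, `e₁ = Pi.single 1 1` and `1 = e₀ + e₁` are nonzero and pairwise distinct:
side conditions for `Finset.sum_insert` on `cellFace w = {w, w + e₀, w + e₁, w + 1}`. [folklore] -/
private theorem cellFace_aux (w : Site 2) :
    w ∉ ({w + Pi.single 0 1, w + Pi.single 1 1, w + 1} : Finset (Site 2)) ∧
      w + Pi.single 0 1 ∉ ({w + Pi.single 1 1, w + 1} : Finset (Site 2)) ∧
        w + Pi.single 1 1 ≠ w + 1 := by
  simp only [mem_insert, mem_singleton, left_eq_add, add_right_inj, Ne]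
  decide

/-- `w` is the lower-left cell of its face. [folklore] -/
theorem self_mem_cellFace (w : Site 2) : w ∈ cellFace w := by
  simp [cellFace]

/-- Membership in a face, unfolded. [folklore] -/
theorem mem_cellFace_iff {w c : Site 2} :
    c ∈ cellFace w ↔ c = w ∨ c = w + Pi.single 0 1 ∨ c = w + Pi.single 1 1 ∨ c = w + 1 := by
  simp [cellFace]

/-- The black count of `CellGridSaddlePercolation.lean` written out over the four cells of the
face. [folklore] -/
theorem blackCount_eq_toNat (σ : Site 2 → Bool) (w : Site 2) :
    blackCount σ w = (σ w).toNat + (σ (w + Pi.single 0 1)).toNat + (σ (w + Pi.single 1 1)).toNat +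
      (σ (w + 1)).toNat := by
  obtain ⟨h1, h2, h3⟩ := cellFace_aux w
  rw [blackCount, card_filter, cellFace, sum_insert h1, sum_insert h2, sum_pair h3]
  cases σ w <;> cases σ (w + Pi.single 0 1) <;> cases σ (w + Pi.single 1 1) <;> cases σ (w + 1) <;>
    rfl

/-- The black count as a sum over the face. [folklore] -/
theorem blackCount_eq_sum (σ : Site 2 → Bool) (w : Site 2) :
    blackCount σ w = ∑ c ∈ cellFace w, (σ c).toNat := by
  rw [blackCount, card_filter]
  exact sum_congr rfl fun c _ => by cases σ c <;> rfl

/-- The grid vertex (face) `w` is an **odd face** of the colouring `σ` — a *corner*, or *turning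
vertex*, of its domain walls — iff an odd number of the four cells around it is black; vacancy
(`0`, `4` black), straight (`2` adjacent) and checkerboard (`2` diagonal) vertices are not.
(Blöte–Nienhuis 1989, §2: the "one bend" vertex of the square-lattice `O(n)` model in the
domain-wall picture; card `corner-fugacity-plane`.) [cite: BloteNienhuis1989, §2] -/
def IsOddFace (σ : Site 2 → Bool) (w : Site 2) : Prop :=
  Odd (blackCount σ w)

/-- Being an odd face is decidable (parity of a natural number). [folklore] -/
instance instDecidablePredIsOddFace (σ : Site 2 → Bool) : DecidablePred (IsOddFace σ) :=
  fun w => inferInstanceAs (Decidable (Odd (blackCount σ w)))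

/-- Odd face = XOR of the four cells. [cite: BloteNienhuis1989, §2] -/
theorem isOddFace_iff_xor (σ : Site 2 → Bool) (w : Site 2) :
    IsOddFace σ w ↔
      ((σ w ^^ σ (w + Pi.single 0 1)) ^^ (σ (w + Pi.single 1 1) ^^ σ (w + 1))) = true := by
  rw [IsOddFace, blackCount_eq_toNat]
  cases σ w <;> cases σ (w + Pi.single 0 1) <;> cases σ (w + Pi.single 1 1) <;> cases σ (w + 1) <;>
    decide

/-- The all-white colouring has no odd face. [folklore] -/
theorem not_isOddFace_white (w : Site 2) : ¬ IsOddFace (fun _ => false) w := by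
  simp [isOddFace_iff_xor]

/-- A checkerboard (saddle) face is not an odd face (it weighs `1`, the coin chooses the pairing). [cite: BloteNienhuis1989, §2] -/
theorem not_isOddFace_of_isCheckerboard {σ : Site 2 → Bool} {w : Site 2} (h : IsCheckerboard σ w) :
    ¬ IsOddFace σ w := by
  obtain ⟨h1, h2, -⟩ := h
  rw [isOddFace_iff_xor, h1, h2]
  cases σ (w + 1) <;> cases σ (w + Pi.single 1 1) <;> decide

/-- Odd faces are invariant under the global colour flip (the parity of `4 - k` is that of `k`). [cite: BloteNienhuis1989, §2] -/
theorem isOddFace_flip_iff (σ : Site 2 → Bool) (w : Site 2) :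
    IsOddFace (fun c => !σ c) w ↔ IsOddFace σ w := by
  rw [isOddFace_iff_xor, isOddFace_iff_xor]
  cases σ w <;> cases σ (w + Pi.single 0 1) <;> cases σ (w + Pi.single 1 1) <;> cases σ (w + 1) <;>
    decide

/-- The number of odd faces (corners of the domain walls) of `σ` among the grid vertices of `V`. [cite: BloteNienhuis1989, §2] -/
def oddFaceCount (V : Finset (Site 2)) (σ : Site 2 → Bool) : ℕ :=
  (V.filter fun v => IsOddFace σ v).card

/-- The all-white colouring has corner count `0`. [folklore] -/
@[simp] theorem oddFaceCount_white (V : Finset (Site 2)) : oddFaceCount V (fun _ => false) = 0 := by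
  simp [oddFaceCount, not_isOddFace_white]

/-- The corner count is flip-invariant. [folklore] -/
@[simp] theorem oddFaceCount_flip (V : Finset (Site 2)) (σ : Site 2 → Bool) :
    oddFaceCount V (fun c => !σ c) = oddFaceCount V σ := by
  simp [oddFaceCount, isOddFace_flip_iff]

/-! ### Vertices attached to a finite volume -/

/-- The grid vertices **meeting** the finite set of cells `Λ`: those whose block contains a cell
of `Λ` (the vertices carrying the interaction of the volume `Λ` with boundary condition, Friedli–
Velenik 2017, §3.1 / Ch. 6). [cite: FriedliVelenik2017, Ch. 6] -/
def verticesMeeting (Λ : Finset (Site 2)) : Finset (Site 2) :=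
  Λ.biUnion fun c => {c, c - Pi.single 0 1, c - Pi.single 1 1, c - 1}

/-- A vertex meets `Λ` iff one of the four cells of its block lies in `Λ`. [cite: FriedliVelenik2017, Ch. 6] -/
theorem mem_verticesMeeting_iff {Λ : Finset (Site 2)} {v : Site 2} :
    v ∈ verticesMeeting Λ ↔ ∃ c ∈ cellFace v, c ∈ Λ := by
  simp only [verticesMeeting, mem_biUnion, mem_insert, mem_singleton]
  constructor
  · rintro ⟨c, hc, h | h | h | h⟩ <;> refine ⟨c, mem_cellFace_iff.2 ?_, hc⟩
    · exact Or.inl h.symm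
    · exact Or.inr (Or.inl (by rw [h]; abel))
    · exact Or.inr (Or.inr (Or.inl (by rw [h]; abel)))
    · exact Or.inr (Or.inr (Or.inr (by rw [h]; abel)))
  · rintro ⟨c, hc', hc⟩
    rcases mem_cellFace_iff.1 hc' with h | h | h | h <;> refine ⟨c, hc, ?_⟩
    · exact Or.inl h.symm
    · exact Or.inr (Or.inl (by rw [h]; abel))
    · exact Or.inr (Or.inr (Or.inl (by rw [h]; abel)))
    · exact Or.inr (Or.inr (Or.inr (by rw [h]; abel)))

/-- The **inner** grid vertices of `Λ`: those whose whole block lies in `Λ` (the vertices of the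
free-boundary-condition Hamiltonian, Friedli–Velenik 2017, §3.1). [cite: FriedliVelenik2017, §3.1] -/
def innerVertices (Λ : Finset (Site 2)) : Finset (Site 2) :=
  Λ.filter fun v => cellFace v ⊆ Λ

/-- A vertex is inner iff its block lies in `Λ`. [cite: FriedliVelenik2017, §3.1] -/
theorem mem_innerVertices_iff {Λ : Finset (Site 2)} {v : Site 2} :
    v ∈ innerVertices Λ ↔ cellFace v ⊆ Λ := by
  simp only [innerVertices, mem_filter, and_iff_right_iff_imp]
  exact fun h => h (self_mem_cellFace v)

/-- Inner vertices meet `Λ`. [folklore] -/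
theorem innerVertices_subset_verticesMeeting (Λ : Finset (Site 2)) :
    innerVertices Λ ⊆ verticesMeeting Λ := fun v hv =>
  mem_verticesMeeting_iff.2 ⟨v, self_mem_cellFace v, (mem_innerVertices_iff.1 hv) (self_mem_cellFace v)⟩

/-! ### Colourings with a boundary condition -/

/-- The colouring equal to `ξ` off `Λ` and black exactly on `s` inside `Λ` (`s ⊆ Λ` the black set
of the volume). [cite: FriedliVelenik2017, §3.1] -/
def boxFill (Λ : Finset (Site 2)) (ξ : Site 2 → Bool) (s : Finset (Site 2)) : Site 2 → Bool :=
  fun x => if x ∈ Λ then decide (x ∈ s) else ξ x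

/-- Inside `Λ`, `boxFill` is the indicator of `s`. [folklore] -/
@[simp] theorem boxFill_apply_of_mem {Λ : Finset (Site 2)} (ξ : Site 2 → Bool) (s : Finset (Site 2))
    {x : Site 2} (hx : x ∈ Λ) : boxFill Λ ξ s x = decide (x ∈ s) := by
  simp [boxFill, hx]

/-- Off `Λ`, `boxFill` is the boundary condition. [folklore] -/
@[simp] theorem boxFill_apply_of_not_mem {Λ : Finset (Site 2)} (ξ : Site 2 → Bool) (s : Finset (Site 2))
    {x : Site 2} (hx : x ∉ Λ) : boxFill Λ ξ s x = ξ x := by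
  simp [boxFill, hx]

/-- `boxFill Λ ξ` is injective on the subsets of `Λ`. [folklore] -/
theorem boxFill_injOn (Λ : Finset (Site 2)) (ξ : Site 2 → Bool) :
    Set.InjOn (boxFill Λ ξ) (↑Λ.powerset : Set (Finset (Site 2))) := by
  intro s hs s' hs' h
  rw [mem_coe, mem_powerset] at hs hs'
  ext x
  constructor
  · intro hx
    have := congrFun h x
    rw [boxFill_apply_of_mem ξ s (hs hx), boxFill_apply_of_mem ξ s' (hs hx)] at this
    simpa [hx] using this.symm
  · intro hx
    have := congrFun h x
    rw [boxFill_apply_of_mem ξ s (hs' hx), boxFill_apply_of_mem ξ s' (hs' hx)] at this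
    simpa [hx] using this

/-- Filling with the empty black set and a white boundary condition gives the all-white
colouring. [folklore] -/
@[simp] theorem boxFill_white_empty (Λ : Finset (Site 2)) :
    boxFill Λ (fun _ => false) ∅ = fun _ => false := by
  funext x
  by_cases hx : x ∈ Λ <;> simp [boxFill, hx]

/-- Every colouring that agrees with `ξ` off `Λ` is a `boxFill`. [folklore] -/
theorem eq_boxFill_of_eqOn {Λ : Finset (Site 2)} {ξ σ : Site 2 → Bool} (h : ∀ x ∉ Λ, σ x = ξ x) :
    σ = boxFill Λ ξ (Λ.filter fun x => σ x = true) := by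
  funext x
  by_cases hx : x ∈ Λ
  · rw [boxFill_apply_of_mem _ _ hx]
    cases hσ : σ x <;> simp [mem_filter, hx, hσ]
  · rw [boxFill_apply_of_not_mem _ _ hx, h x hx]

/-! ### The finite-volume Gibbs distribution of the corner interaction -/

/-- The Boltzmann weight `t ^ #corners` of a colouring, the corners being counted over the vertex
set `V` (in `ℝ≥0∞`; `0 ^ 0 = 1`, so at `t = 0` this is the indicator of "no corner in `V`").
(Blöte–Nienhuis 1989, §2, weight `u` per bend at `n = 1`; arXiv:2211.12379 §3.1.) [cite: MorinduchesneKlumperPearce2023, §3.1] -/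
def cornerWeight (t : ℝ≥0) (V : Finset (Site 2)) (σ : Site 2 → Bool) : ℝ≥0∞ :=
  (t : ℝ≥0∞) ^ oddFaceCount V σ

/-- The **partition function** `Z = Σ_{σ = ξ off Λ} t ^ #corners(σ, V)`. [cite: FriedliVelenik2017, Ch. 6] -/
def cornerPartitionFunction (t : ℝ≥0) (V Λ : Finset (Site 2)) (ξ : Site 2 → Bool) : ℝ≥0∞ :=
  ∑ s ∈ Λ.powerset, cornerWeight t V (boxFill Λ ξ s)

/-- The **finite-volume Gibbs distribution** of the corner interaction in the volume `Λ` with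
boundary condition `ξ` and interaction vertices `V`: the probability measure on colourings of all
of `ℤ²` carried by `{σ | σ = ξ off Λ}` with `P(σ) = t ^ #corners(σ, V) / Z` (the zero measure if
`Z = 0`, which happens only for `t = 0` and a boundary condition admitting no corner-free filling).
Used with `V = verticesMeeting Λ` (boundary condition `ξ`) and `V = innerVertices Λ` (free
boundary condition). (Friedli–Velenik 2017, Ch. 6, finite-volume Gibbs distribution of a finite-range
potential.) [cite: FriedliVelenik2017, Ch. 6] -/
def cornerGibbsMeasure (t : ℝ≥0) (V Λ : Finset (Site 2)) (ξ : Site 2 → Bool) :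
    Measure (Site 2 → Bool) :=
  (cornerPartitionFunction t V Λ ξ)⁻¹ •
    ∑ s ∈ Λ.powerset, cornerWeight t V (boxFill Λ ξ s) • Measure.dirac (boxFill Λ ξ s)

/-- The weight of a colouring is finite. [folklore] -/
theorem cornerWeight_ne_top (t : ℝ≥0) (V : Finset (Site 2)) (σ : Site 2 → Bool) :
    cornerWeight t V σ ≠ ∞ :=
  ENNReal.pow_ne_top ENNReal.coe_ne_top

/-- For `t ≠ 0` every colouring has nonzero weight. [folklore] -/
theorem cornerWeight_ne_zero {t : ℝ≥0} (ht : t ≠ 0) (V : Finset (Site 2)) (σ : Site 2 → Bool) :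
    cornerWeight t V σ ≠ 0 :=
  pow_ne_zero _ (by simpa using ht)

/-- The all-white colouring has weight `1` for every `t` (also `t = 0`). [folklore] -/
@[simp] theorem cornerWeight_white (t : ℝ≥0) (V : Finset (Site 2)) :
    cornerWeight t V (fun _ => false) = 1 := by
  simp [cornerWeight]

/-- At `t = 1` every colouring has weight `1`. [folklore] -/
@[simp] theorem cornerWeight_one (V : Finset (Site 2)) (σ : Site 2 → Bool) :
    cornerWeight 1 V σ = 1 := by
  simp [cornerWeight]

/-- At `t = 0` a colouring with a corner in `V` has weight `0` … [folklore] -/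
theorem cornerWeight_zero_of_isOddFace {V : Finset (Site 2)} {σ : Site 2 → Bool} {v : Site 2}
    (hv : v ∈ V) (hc : IsOddFace σ v) : cornerWeight 0 V σ = 0 := by
  rw [cornerWeight, ENNReal.coe_zero, zero_pow]
  exact card_ne_zero.2 ⟨v, mem_filter.2 ⟨hv, hc⟩⟩

/-- … and a colouring with no corner in `V` has weight `1` (`0 ^ 0 = 1`): at `t = 0` the Gibbs
distribution is the uniform measure on the corner-free compatible colourings (the freezing point
`M(0, b)` of the corner-fugacity plane). [folklore] -/
theorem cornerWeight_zero_of_forall_not_isOddFace {V : Finset (Site 2)} {σ : Site 2 → Bool}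
    (h : ∀ v ∈ V, ¬ IsOddFace σ v) : cornerWeight 0 V σ = 1 := by
  rw [cornerWeight, oddFaceCount, filter_eq_empty_iff.2 h, card_empty, pow_zero]

/-- The partition function is finite. [cite: FriedliVelenik2017, Ch. 6] -/
theorem cornerPartitionFunction_ne_top (t : ℝ≥0) (V Λ : Finset (Site 2)) (ξ : Site 2 → Bool) :
    cornerPartitionFunction t V Λ ξ ≠ ∞ :=
  ENNReal.sum_ne_top.2 fun _ _ => cornerWeight_ne_top _ _ _

/-- A single term bounds the partition function from below. [folklore] -/
theorem cornerWeight_le_cornerPartitionFunction (t : ℝ≥0) (V : Finset (Site 2)) {Λ s : Finset (Site 2)}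
    (ξ : Site 2 → Bool) (hs : s ⊆ Λ) :
    cornerWeight t V (boxFill Λ ξ s) ≤ cornerPartitionFunction t V Λ ξ :=
  single_le_sum (f := fun s => cornerWeight t V (boxFill Λ ξ s)) (fun _ _ => zero_le)
    (mem_powerset.2 hs)

/-- For `t ≠ 0` the partition function is nonzero. [cite: FriedliVelenik2017, Ch. 6] -/
theorem cornerPartitionFunction_ne_zero {t : ℝ≥0} (ht : t ≠ 0) (V Λ : Finset (Site 2))
    (ξ : Site 2 → Bool) : cornerPartitionFunction t V Λ ξ ≠ 0 := fun h =>
  cornerWeight_ne_zero ht V (boxFill Λ ξ ∅)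
    (le_antisymm (h ▸ cornerWeight_le_cornerPartitionFunction t V ξ (empty_subset Λ)) zero_le)

/-- With a white boundary condition the partition function is at least `1` (the all-white filling),
for every `t ≥ 0`. [folklore] -/
theorem one_le_cornerPartitionFunction_white (t : ℝ≥0) (V Λ : Finset (Site 2)) :
    1 ≤ cornerPartitionFunction t V Λ (fun _ => false) := by
  simpa using cornerWeight_le_cornerPartitionFunction t V (fun _ => false) (empty_subset Λ)

/-- At `t = 1` the partition function is `2 ^ |Λ|`. [folklore] -/
theorem cornerPartitionFunction_one (V Λ : Finset (Site 2)) (ξ : Site 2 → Bool) :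
    cornerPartitionFunction 1 V Λ ξ = 2 ^ Λ.card := by
  simp [cornerPartitionFunction, card_powerset]


/-- The Gibbs probability of a set of colourings: the normalised total weight of the compatible
colourings (`boxFill Λ ξ s`, `s ⊆ Λ`) lying in it. [cite: FriedliVelenik2017, Ch. 6] -/
theorem cornerGibbsMeasure_apply (t : ℝ≥0) (V Λ : Finset (Site 2)) (ξ : Site 2 → Bool)
    (A : Set (Site 2 → Bool)) :
    cornerGibbsMeasure t V Λ ξ A =
      (cornerPartitionFunction t V Λ ξ)⁻¹ *
        ∑ s ∈ Λ.powerset, A.indicator (cornerWeight t V) (boxFill Λ ξ s) := by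
  rw [cornerGibbsMeasure, Measure.smul_apply, smul_eq_mul, Measure.finsetSum_apply]
  congr 1
  refine sum_congr rfl fun s _ => ?_
  rw [Measure.smul_apply, smul_eq_mul, Measure.dirac_apply]
  by_cases h : boxFill Λ ξ s ∈ A <;> simp [h]

/-- The total mass of the Gibbs distribution is `Z⁻¹ * Z`. [folklore] -/
theorem cornerGibbsMeasure_univ (t : ℝ≥0) (V Λ : Finset (Site 2)) (ξ : Site 2 → Bool) :
    cornerGibbsMeasure t V Λ ξ Set.univ =
      (cornerPartitionFunction t V Λ ξ)⁻¹ * cornerPartitionFunction t V Λ ξ := by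
  rw [cornerGibbsMeasure_apply]
  simp [cornerPartitionFunction]

/-- The Gibbs distribution is always a finite measure (total mass `Z⁻¹ Z ≤ 1`). [folklore] -/
instance instIsFiniteMeasureCornerGibbsMeasure (t : ℝ≥0) (V Λ : Finset (Site 2)) (ξ : Site 2 → Bool) :
    IsFiniteMeasure (cornerGibbsMeasure t V Λ ξ) :=
  ⟨by
    rw [cornerGibbsMeasure_univ]
    by_cases hZ : cornerPartitionFunction t V Λ ξ = 0
    · simp [hZ]
    · rw [ENNReal.inv_mul_cancel hZ (cornerPartitionFunction_ne_top _ _ _ _)]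
      exact ENNReal.one_lt_top⟩

/-- Whenever the partition function is nonzero (e.g. `t ≠ 0`, or a white boundary condition) the
Gibbs distribution is a probability measure. [cite: FriedliVelenik2017, Ch. 6] -/
theorem isProbabilityMeasure_cornerGibbsMeasure {t : ℝ≥0} {V Λ : Finset (Site 2)} {ξ : Site 2 → Bool}
    (hZ : cornerPartitionFunction t V Λ ξ ≠ 0) :
    IsProbabilityMeasure (cornerGibbsMeasure t V Λ ξ) :=
  ⟨by rw [cornerGibbsMeasure_univ, ENNReal.inv_mul_cancel hZ (cornerPartitionFunction_ne_top _ _ _ _)]⟩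

/-- For `t ≠ 0` the Gibbs distribution is a probability measure. [cite: FriedliVelenik2017, Ch. 6] -/
theorem isProbabilityMeasure_cornerGibbsMeasure_of_ne_zero {t : ℝ≥0} (ht : t ≠ 0)
    (V Λ : Finset (Site 2)) (ξ : Site 2 → Bool) :
    IsProbabilityMeasure (cornerGibbsMeasure t V Λ ξ) :=
  isProbabilityMeasure_cornerGibbsMeasure (cornerPartitionFunction_ne_zero ht V Λ ξ)

/-- With a white boundary condition the Gibbs distribution is a probability measure for every
`t ≥ 0` (at `t = 0`: uniform on the corner-free fillings, among which the all-white one). [folklore] -/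
instance instIsProbabilityMeasureCornerGibbsMeasureWhite (t : ℝ≥0) (V Λ : Finset (Site 2)) :
    IsProbabilityMeasure (cornerGibbsMeasure t V Λ (fun _ => false)) :=
  isProbabilityMeasure_cornerGibbsMeasure
    (ne_of_gt (lt_of_lt_of_le zero_lt_one (one_le_cornerPartitionFunction_white t V Λ)))

/-- **Gibbs form.** The probability of the compatible colouring with black set `s ⊆ Λ` is
`t ^ #corners / Z`. [cite: FriedliVelenik2017, Ch. 6] -/
theorem cornerGibbsMeasure_apply_singleton (t : ℝ≥0) (V : Finset (Site 2)) {Λ s : Finset (Site 2)}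
    (ξ : Site 2 → Bool) (hs : s ⊆ Λ) :
    cornerGibbsMeasure t V Λ ξ {boxFill Λ ξ s} =
      (cornerPartitionFunction t V Λ ξ)⁻¹ * cornerWeight t V (boxFill Λ ξ s) := by
  rw [cornerGibbsMeasure_apply]
  congr 1
  rw [sum_eq_single_of_mem s (mem_powerset.2 hs)]
  · simp
  · intro s' hs' hne
    rw [Set.indicator_of_notMem]
    rw [Set.mem_singleton_iff]
    exact fun h => hne (boxFill_injOn Λ ξ (mem_coe.2 hs') (mem_coe.2 (mem_powerset.2 hs)) h)

/-- **Boundary condition.** The Gibbs distribution gives no mass to colourings that differ from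
`ξ` somewhere off `Λ`. [cite: FriedliVelenik2017, Ch. 6] -/
theorem cornerGibbsMeasure_apply_eq_zero_of_forall (t : ℝ≥0) (V Λ : Finset (Site 2)) (ξ : Site 2 → Bool)
    {A : Set (Site 2 → Bool)} (hA : ∀ σ ∈ A, ∃ x ∉ Λ, σ x ≠ ξ x) :
    cornerGibbsMeasure t V Λ ξ A = 0 := by
  rw [cornerGibbsMeasure_apply]
  refine mul_eq_zero_of_right _ (sum_eq_zero fun s _ => Set.indicator_of_notMem (fun h => ?_) _)
  obtain ⟨x, hx, hne⟩ := hA _ h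
  exact hne (boxFill_apply_of_not_mem ξ s hx)

/-- Almost every colouring agrees with the boundary condition off `Λ`. [cite: FriedliVelenik2017, Ch. 6] -/
theorem ae_eqOn_cornerGibbsMeasure (t : ℝ≥0) (V Λ : Finset (Site 2)) (ξ : Site 2 → Bool) :
    ∀ᵐ σ ∂cornerGibbsMeasure t V Λ ξ, ∀ x ∉ Λ, σ x = ξ x := by
  rw [ae_iff]
  exact cornerGibbsMeasure_apply_eq_zero_of_forall t V Λ ξ fun σ hσ => by simpa using hσ

/-- **Freezing.** At `t = 0` the Gibbs distribution gives no mass to colourings with a corner at an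
interaction vertex: it is carried by the corner-free compatible colourings (for the free measure on
a rectangle these are the XOR colourings `σ (x, y) = a x ⊕ b y`). [folklore] -/
theorem cornerGibbsMeasure_zero_apply_setOf_isOddFace (V Λ : Finset (Site 2)) (ξ : Site 2 → Bool) :
    cornerGibbsMeasure 0 V Λ ξ {σ | ∃ v ∈ V, IsOddFace σ v} = 0 := by
  rw [cornerGibbsMeasure_apply]
  refine mul_eq_zero_of_right _ (sum_eq_zero fun s _ => ?_)
  by_cases h : boxFill Λ ξ s ∈ {σ : Site 2 → Bool | ∃ v ∈ V, IsOddFace σ v}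
  · rw [Set.indicator_of_mem h]
    obtain ⟨v, hv, hc⟩ := h
    exact cornerWeight_zero_of_isOddFace hv hc
  · exact Set.indicator_of_notMem h _

/-- At `t = 0`, almost every colouring is corner-free on `V`. [folklore] -/
theorem ae_not_isOddFace_cornerGibbsMeasure_zero (V Λ : Finset (Site 2)) (ξ : Site 2 → Bool) :
    ∀ᵐ σ ∂cornerGibbsMeasure 0 V Λ ξ, ∀ v ∈ V, ¬ IsOddFace σ v := by
  rw [ae_iff]
  simpa only [not_forall, not_not, exists_prop] using
    cornerGibbsMeasure_zero_apply_setOf_isOddFace V Λ ξ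

/-- At `t = 1` (no interaction) the Gibbs distribution is the uniform measure on the `2 ^ |Λ|`
compatible colourings, whatever `V`. [folklore] -/
theorem cornerGibbsMeasure_one_apply_singleton (V : Finset (Site 2)) {Λ s : Finset (Site 2)}
    (ξ : Site 2 → Bool) (hs : s ⊆ Λ) :
    cornerGibbsMeasure 1 V Λ ξ {boxFill Λ ξ s} = (2 ^ Λ.card)⁻¹ := by
  rw [cornerGibbsMeasure_apply_singleton 1 V ξ hs, cornerPartitionFunction_one]
  simp

/-! ### Coins -/

/-- The law of the coins: i.i.d. Bernoulli, `κ v = true` with probability `b`, at every grid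
vertex `v` of `ℤ²` (Mathlib's `Measure.infinitePi` of `Ber(true, false, b)`).  At a checkerboard
vertex the coin selects which diagonal pair of equal-coloured cells is joined; elsewhere it is
irrelevant. (arXiv:2211.12379 §3.1: the two pairings `ρ₈`, `ρ₉` of the face operator.) [cite: MorinduchesneKlumperPearce2023, §3.1] -/
def coinMeasure (b : unitInterval) : Measure (Site 2 → Bool) :=
  Measure.infinitePi fun _ : Site 2 => (bernoulliMeasure true false b : Measure Bool)

/-- The coin law is a probability measure. [folklore] -/
instance instIsProbabilityMeasureCoinMeasure (b : unitInterval) : IsProbabilityMeasure (coinMeasure b) := by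
  unfold coinMeasure; infer_instance

/-- With bias `1` all coins are `true` almost surely: `coinMeasure 1 = δ_{κ ≡ true}` (the
`u = π/3` member of the Izergin–Korepin line: one fixed diagonal). [cite: MorinduchesneKlumperPearce2023, §3.6] -/
@[simp] theorem coinMeasure_one : coinMeasure 1 = Measure.dirac (fun _ => true) := by
  simp [coinMeasure]

/-- With bias `0` all coins are `false` almost surely. [folklore] -/
@[simp] theorem coinMeasure_zero : coinMeasure 0 = Measure.dirac (fun _ => false) := by
  simp [coinMeasure]

/-! ### The corner-fugacity measures -/

/-- The **corner-fugacity measure** `M(t, b)` in the finite volume `Λ` with boundary colouring `ξ`: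
colourings `σ = ξ` off `Λ` with density proportional to `t ^ #{vertices meeting Λ that are corners}`
(turning vertices weigh `t`; vacancy, straight and checkerboard vertices weigh `1`), times
independent `Bernoulli(b)` coins at all grid vertices.  This is the `n = 1` square-lattice `O(n)` /
dilute loop model in its domain-wall (cell-colouring) representation, with bend weight `t` and the
two pairings of a two-bend vertex weighted `b`, `1 - b` (Blöte–Nienhuis 1989 §2; arXiv:2211.12379
§3.1). [cite: BloteNienhuis1989, §2] -/
def cornerFugacityMeasure (t : ℝ≥0) (b : unitInterval) (Λ : Finset (Site 2)) (ξ : Site 2 → Bool) :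
    Measure ((Site 2 → Bool) × (Site 2 → Bool)) :=
  (cornerGibbsMeasure t (verticesMeeting Λ) Λ ξ).prod (coinMeasure b)

/-- The **free-boundary** corner-fugacity measure in `Λ`: only vertices whose whole block lies in
`Λ` are weighed, cells off `Λ` are white, coins i.i.d. `Bernoulli(b)`.  (Friedli–Velenik 2017 §3.1,
free boundary condition.) [cite: FriedliVelenik2017, §3.1] -/
def freeCornerFugacityMeasure (t : ℝ≥0) (b : unitInterval) (Λ : Finset (Site 2)) :
    Measure ((Site 2 → Bool) × (Site 2 → Bool)) :=
  (cornerGibbsMeasure t (innerVertices Λ) Λ (fun _ => false)).prod (coinMeasure b)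

/-- For `t ≠ 0` the corner-fugacity measure is a probability measure. [folklore] -/
theorem isProbabilityMeasure_cornerFugacityMeasure {t : ℝ≥0} (ht : t ≠ 0) (b : unitInterval)
    (Λ : Finset (Site 2)) (ξ : Site 2 → Bool) :
    IsProbabilityMeasure (cornerFugacityMeasure t b Λ ξ) := by
  haveI := isProbabilityMeasure_cornerGibbsMeasure_of_ne_zero ht (verticesMeeting Λ) Λ ξ
  unfold cornerFugacityMeasure; infer_instance

/-- `NeZero` form of the previous statement, as an instance. [folklore] -/
instance instIsProbabilityMeasureCornerFugacityMeasure (t : ℝ≥0) [NeZero t] (b : unitInterval)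
    (Λ : Finset (Site 2)) (ξ : Site 2 → Bool) :
    IsProbabilityMeasure (cornerFugacityMeasure t b Λ ξ) :=
  isProbabilityMeasure_cornerFugacityMeasure (NeZero.ne t) b Λ ξ

/-- With a white boundary condition the corner-fugacity measure is a probability measure for
every `t ≥ 0`. [folklore] -/
instance instIsProbabilityMeasureCornerFugacityMeasureWhite (t : ℝ≥0) (b : unitInterval)
    (Λ : Finset (Site 2)) :
    IsProbabilityMeasure (cornerFugacityMeasure t b Λ (fun _ => false)) := by
  unfold cornerFugacityMeasure; infer_instance

/-- The free-boundary corner-fugacity measure is a probability measure for every `t ≥ 0`. [folklore] -/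
instance instIsProbabilityMeasureFreeCornerFugacityMeasure (t : ℝ≥0) (b : unitInterval)
    (Λ : Finset (Site 2)) :
    IsProbabilityMeasure (freeCornerFugacityMeasure t b Λ) := by
  unfold freeCornerFugacityMeasure; infer_instance

/-- **Independence of colouring and coins.** The probability of a product event factorises. [cite: MorinduchesneKlumperPearce2023, §3.1] -/
theorem cornerFugacityMeasure_prod (t : ℝ≥0) (b : unitInterval) (Λ : Finset (Site 2)) (ξ : Site 2 → Bool)
    (A B : Set (Site 2 → Bool)) :
    cornerFugacityMeasure t b Λ ξ (A ×ˢ B) =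
      cornerGibbsMeasure t (verticesMeeting Λ) Λ ξ A * coinMeasure b B := by
  rw [cornerFugacityMeasure, Measure.prod_prod]

/-- The colouring marginal of the corner-fugacity measure is the Gibbs distribution. [folklore] -/
theorem cornerFugacityMeasure_map_fst (t : ℝ≥0) (b : unitInterval) (Λ : Finset (Site 2)) (ξ : Site 2 → Bool) :
    (cornerFugacityMeasure t b Λ ξ).map Prod.fst = cornerGibbsMeasure t (verticesMeeting Λ) Λ ξ := by
  rw [cornerFugacityMeasure, Measure.map_fst_prod, measure_univ, one_smul]

/-- The coin marginal of the free corner-fugacity measure is the i.i.d. coin law. [folklore] -/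
theorem freeCornerFugacityMeasure_map_snd (t : ℝ≥0) (b : unitInterval) (Λ : Finset (Site 2)) :
    (freeCornerFugacityMeasure t b Λ).map Prod.snd = coinMeasure b := by
  rw [freeCornerFugacityMeasure, Measure.map_snd_prod, measure_univ, one_smul]

/-! ### The Izergin–Korepin specialisation -/

/-- The corner fugacity `t(u) = √3 / (2 sin u)` of the `n = 1` dilute `A₂⁽²⁾` model at `λ = π/3`
and spectral parameter `u` (the bend weight `ρ₂ / ρ₁` of arXiv:2211.12379 §3.1 at `λ = π/3`;
clamped to `ℝ≥0` by `Real.toNNReal`, relevant range `u ∈ [π/3, 2π/3]`). [cite: MorinduchesneKlumperPearce2023, §3.1] -/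
def ikCornerFugacity (u : ℝ) : ℝ≥0 :=
  (Real.sqrt 3 / (2 * Real.sin u)).toNNReal

/-- The coin bias `b(u) = sin (2π/3 - u) / sin u` of the `n = 1` dilute `A₂⁽²⁾` model at
`λ = π/3` (the pairing weight `ρ₈ / ρ₁` of arXiv:2211.12379 §3.1; `ρ₉ / ρ₁ = 1 - b(u)`; clamped to
`[0, 1]` by `Set.projIcc`, where it lies anyway for `u ∈ [π/3, 2π/3]`). [cite: MorinduchesneKlumperPearce2023, §3.1] -/
def ikCoinBias (u : ℝ) : unitInterval :=
  Set.projIcc (0 : ℝ) 1 zero_le_one (Real.sin (2 * Real.pi / 3 - u) / Real.sin u)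

/-- The **Izergin–Korepin measure** `IK(u)` in the volume `Λ` with boundary colouring `ξ`: the
`n = 1` dilute `A₂⁽²⁾` loop model at `λ = π/3`, spectral parameter `u ∈ [π/3, 2π/3]`, in its
cell-colouring representation, i.e. the corner-fugacity measure at `(t(u), b(u))`; vertex weights
(vacancy, straight, turn, pairings) `= (1, 1, √3/(2 sin u), b(u), 1 - b(u))`, at `u = π/2`:
`(1, 1, √3/2, ½, ½)`. (arXiv:2211.12379 §3.1, §3.6; Warnaar–Nienhuis–Seaton 1992.) [cite: MorinduchesneKlumperPearce2023, §3.6] -/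
def ikMeasure (u : ℝ) (Λ : Finset (Site 2)) (ξ : Site 2 → Bool) :
    Measure ((Site 2 → Bool) × (Site 2 → Bool)) :=
  cornerFugacityMeasure (ikCornerFugacity u) (ikCoinBias u) Λ ξ

/-- The free-boundary Izergin–Korepin measure in `Λ`. [cite: MorinduchesneKlumperPearce2023, §3.6] -/
def freeIKMeasure (u : ℝ) (Λ : Finset (Site 2)) : Measure ((Site 2 → Bool) × (Site 2 → Bool)) :=
  freeCornerFugacityMeasure (ikCornerFugacity u) (ikCoinBias u) Λ

/-- `sin (π/3) ≠ 0`. [folklore] -/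
private theorem sin_pi_div_three_ne_zero : Real.sin (Real.pi / 3) ≠ 0 := by
  rw [Real.sin_pi_div_three]; positivity

/-- At `u = π/3` the corner fugacity is `1` (no corner interaction: i.i.d. fair colouring).
(arXiv:2211.12379 §3.6: eight tiles of weight `1`.) [cite: MorinduchesneKlumperPearce2023, §3.6] -/
@[simp] theorem ikCornerFugacity_pi_div_three : ikCornerFugacity (Real.pi / 3) = 1 := by
  rw [ikCornerFugacity, Real.sin_pi_div_three]
  have h3 : Real.sqrt 3 ≠ 0 := by positivity
  rw [show (2 : ℝ) * (Real.sqrt 3 / 2) = Real.sqrt 3 by ring, div_self h3, Real.toNNReal_one]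

/-- At `u = π/3` the coin bias is `1` (the ninth tile has weight `0`: one fixed diagonal, site
percolation on the triangular lattice). [cite: MorinduchesneKlumperPearce2023, §3.6] -/
@[simp] theorem ikCoinBias_pi_div_three : ikCoinBias (Real.pi / 3) = 1 := by
  rw [ikCoinBias, show 2 * Real.pi / 3 - Real.pi / 3 = Real.pi / 3 by ring,
    div_self sin_pi_div_three_ne_zero]
  exact Set.projIcc_right _

/-- At the isotropic point `u = π/2` the corner fugacity is `√3/2`. [cite: MorinduchesneKlumperPearce2023, §3.6] -/
theorem coe_ikCornerFugacity_pi_div_two : (ikCornerFugacity (Real.pi / 2) : ℝ) = Real.sqrt 3 / 2 := by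
  rw [ikCornerFugacity, Real.sin_pi_div_two, mul_one, Real.coe_toNNReal _ (by positivity)]

/-- At the isotropic point `u = π/2` the coins are fair, `b = ½`. [cite: MorinduchesneKlumperPearce2023, §3.6] -/
theorem coe_ikCoinBias_pi_div_two : (ikCoinBias (Real.pi / 2) : ℝ) = 1 / 2 := by
  rw [ikCoinBias, show 2 * Real.pi / 3 - Real.pi / 2 = Real.pi / 6 by ring, Real.sin_pi_div_six,
    Real.sin_pi_div_two, div_one, Set.projIcc_of_mem _ ⟨by norm_num, by norm_num⟩]

/-- On the physical range `u ∈ [π/3, 2π/3]` the clamp in `ikCoinBias` is inactive: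
`b(u) = sin (2π/3 - u) / sin u ∈ [0, 1]`. [cite: MorinduchesneKlumperPearce2023, §3.1] -/
theorem coe_ikCoinBias {u : ℝ} (hu : u ∈ Set.Icc (Real.pi / 3) (2 * Real.pi / 3)) :
    (ikCoinBias u : ℝ) = Real.sin (2 * Real.pi / 3 - u) / Real.sin u := by
  have hpi := Real.pi_pos
  have hsin : 0 < Real.sin u :=
    Real.sin_pos_of_pos_of_lt_pi (by linarith [hu.1]) (by linarith [hu.2])
  have hnum : 0 ≤ Real.sin (2 * Real.pi / 3 - u) :=
    Real.sin_nonneg_of_nonneg_of_le_pi (by linarith [hu.2]) (by linarith [hu.1])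
  have hle : Real.sin (2 * Real.pi / 3 - u) ≤ Real.sin u := by
    have h := Real.sin_sub_sin u (2 * Real.pi / 3 - u)
    have h1 : (u - (2 * Real.pi / 3 - u)) / 2 = u - Real.pi / 3 := by ring
    have h2 : (u + (2 * Real.pi / 3 - u)) / 2 = Real.pi / 3 := by ring
    rw [h1, h2, Real.cos_pi_div_three] at h
    have h3 : 0 ≤ Real.sin (u - Real.pi / 3) :=
      Real.sin_nonneg_of_nonneg_of_le_pi (by linarith [hu.1]) (by linarith [hu.2])
    linarith
  rw [ikCoinBias, Set.projIcc_of_mem _ ⟨div_nonneg hnum hsin.le, (div_le_one hsin).2 hle⟩]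

/-- On `(0, π)` the clamp in `ikCornerFugacity` is inactive: `t(u) = √3 / (2 sin u) > 0`. [cite: MorinduchesneKlumperPearce2023, §3.1] -/
theorem coe_ikCornerFugacity {u : ℝ} (hu : u ∈ Set.Ioo 0 Real.pi) :
    (ikCornerFugacity u : ℝ) = Real.sqrt 3 / (2 * Real.sin u) := by
  have hsin : 0 < Real.sin u := Real.sin_pos_of_pos_of_lt_pi hu.1 hu.2
  rw [ikCornerFugacity, Real.coe_toNNReal _ (by positivity)]

/-- On `(0, π)` the corner fugacity is nonzero, so `ikMeasure u` is a probability measure for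
every boundary condition. [folklore] -/
theorem ikCornerFugacity_ne_zero {u : ℝ} (hu : u ∈ Set.Ioo 0 Real.pi) : ikCornerFugacity u ≠ 0 := by
  have hsin : 0 < Real.sin u := Real.sin_pos_of_pos_of_lt_pi hu.1 hu.2
  have : (0 : ℝ) < ikCornerFugacity u := by rw [coe_ikCornerFugacity hu]; positivity
  exact ne_of_gt (by exact_mod_cast this)

/-- On `(0, π)` the Izergin–Korepin measure is a probability measure for every boundary
colouring. [folklore] -/
theorem isProbabilityMeasure_ikMeasure {u : ℝ} (hu : u ∈ Set.Ioo 0 Real.pi) (Λ : Finset (Site 2))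
    (ξ : Site 2 → Bool) : IsProbabilityMeasure (ikMeasure u Λ ξ) :=
  isProbabilityMeasure_cornerFugacityMeasure (ikCornerFugacity_ne_zero hu) _ Λ ξ

/-- The free Izergin–Korepin measure is a probability measure (every `u`). [folklore] -/
instance instIsProbabilityMeasureFreeIKMeasure (u : ℝ) (Λ : Finset (Site 2)) :
    IsProbabilityMeasure (freeIKMeasure u Λ) := by
  unfold freeIKMeasure; infer_instance

/-- **The `u = π/3` member is site percolation with one fixed diagonal**: the free IK measure at
`u = π/3` is the uniform (i.i.d. fair) colouring of `Λ`, white outside, times `δ_{κ ≡ true}`.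
(arXiv:2211.12379 §3.6.) [cite: MorinduchesneKlumperPearce2023, §3.6] -/
theorem freeIKMeasure_pi_div_three (Λ : Finset (Site 2)) :
    freeIKMeasure (Real.pi / 3) Λ =
      (cornerGibbsMeasure 1 (innerVertices Λ) Λ (fun _ => false)).prod (Measure.dirac fun _ => true) := by
  rw [freeIKMeasure, freeCornerFugacityMeasure, ikCornerFugacity_pi_div_three, ikCoinBias_pi_div_three,
    coinMeasure_one]

/-- Boundary-condition version: the IK measure at `u = π/3` is the uniform colouring of `Λ` glued
to `ξ`, times `δ_{κ ≡ true}`. [cite: MorinduchesneKlumperPearce2023, §3.6] -/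
theorem ikMeasure_pi_div_three (Λ : Finset (Site 2)) (ξ : Site 2 → Bool) :
    ikMeasure (Real.pi / 3) Λ ξ =
      (cornerGibbsMeasure 1 (verticesMeeting Λ) Λ ξ).prod (Measure.dirac fun _ => true) := by
  rw [ikMeasure, cornerFugacityMeasure, ikCornerFugacity_pi_div_three, ikCoinBias_pi_div_three,
    coinMeasure_one]


/-! ### Colour flip and coin flip -/

/-- Flipping a compatible colouring flips the boundary condition and complements the black set. [folklore] -/
theorem boxFill_flip (Λ : Finset (Site 2)) (ξ : Site 2 → Bool) (s : Finset (Site 2)) :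
    (fun c => !boxFill Λ ξ s c) = boxFill Λ (fun c => !ξ c) (Λ \ s) := by
  funext c
  by_cases hc : c ∈ Λ
  · simp [boxFill, hc, mem_sdiff]
  · simp [boxFill, hc]

/-- The weight of a colouring is invariant under the global colour flip (colour-blindness of the
corner interaction). [cite: BloteNienhuis1989, §2] -/
@[simp] theorem cornerWeight_flip (t : ℝ≥0) (V : Finset (Site 2)) (σ : Site 2 → Bool) :
    cornerWeight t V (fun c => !σ c) = cornerWeight t V σ := by
  rw [cornerWeight, cornerWeight, oddFaceCount_flip]

/-- Reindexing a sum over the subsets of `Λ` by complementation. [folklore] -/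
private theorem sum_powerset_sdiff (Λ : Finset (Site 2)) {M : Type*} [AddCommMonoid M]
    (F : Finset (Site 2) → M) : ∑ s ∈ Λ.powerset, F (Λ \ s) = ∑ s ∈ Λ.powerset, F s := by
  refine sum_nbij' (fun s => Λ \ s) (fun s => Λ \ s) (fun s _ => mem_powerset.2 sdiff_subset)
    (fun s _ => mem_powerset.2 sdiff_subset) (fun s hs => ?_) (fun s hs => ?_) (fun _ _ => rfl)
  · exact Finset.sdiff_sdiff_eq_self (mem_powerset.1 hs)
  · exact Finset.sdiff_sdiff_eq_self (mem_powerset.1 hs)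

/-- The partition function is invariant under flipping the boundary condition. [cite: BloteNienhuis1989, §2] -/
theorem cornerPartitionFunction_flip (t : ℝ≥0) (V Λ : Finset (Site 2)) (ξ : Site 2 → Bool) :
    cornerPartitionFunction t V Λ (fun c => !ξ c) = cornerPartitionFunction t V Λ ξ := by
  unfold cornerPartitionFunction
  rw [← sum_powerset_sdiff Λ fun s => cornerWeight t V (boxFill Λ (fun c => !ξ c) s)]
  refine sum_congr rfl fun s _ => ?_
  rw [← boxFill_flip, cornerWeight_flip]

/-- Push-forward of a finite combination of Dirac masses. [folklore] -/
private theorem map_finsetSum_smul_dirac {ι : Type*} (S : Finset ι) (w : ι → ℝ≥0∞) (x : ι → (Site 2 → Bool))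
    {f : (Site 2 → Bool) → (Site 2 → Bool)} (hf : Measurable f) :
    (∑ i ∈ S, w i • Measure.dirac (x i)).map f = ∑ i ∈ S, w i • Measure.dirac (f (x i)) := by
  classical
  induction S using Finset.induction_on with
  | empty => simp
  | insert a S ha ih =>
    rw [sum_insert ha, sum_insert ha, Measure.map_add _ _ hf, ih, Measure.map_smul,
      Measure.map_dirac' hf]

/-- The global colour flip of colourings is measurable. [folklore] -/
theorem measurable_flip : Measurable fun (σ : Site 2 → Bool) (c : Site 2) => !σ c :=
  measurable_pi_lambda _ fun c => (Measurable.of_discrete (f := fun a : Bool => !a)).comp (measurable_pi_apply c)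

/-- **Colour-flip covariance.** The image of the Gibbs distribution with boundary condition `ξ`
under the global colour flip is the Gibbs distribution with boundary condition `¬ξ` (same `t`,
same interaction vertices): the corner interaction is colour-blind. [cite: BloteNienhuis1989, §2] -/
theorem cornerGibbsMeasure_map_flip (t : ℝ≥0) (V Λ : Finset (Site 2)) (ξ : Site 2 → Bool) :
    (cornerGibbsMeasure t V Λ ξ).map (fun σ c => !σ c) = cornerGibbsMeasure t V Λ (fun c => !ξ c) := by
  rw [cornerGibbsMeasure, cornerGibbsMeasure, Measure.map_smul, cornerPartitionFunction_flip,
    map_finsetSum_smul_dirac _ _ _ measurable_flip,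
    ← sum_powerset_sdiff Λ fun s =>
      cornerWeight t V (boxFill Λ (fun c => !ξ c) s) • Measure.dirac (boxFill Λ (fun c => !ξ c) s)]
  refine congrArg _ (sum_congr rfl fun s _ => ?_)
  simp only [← boxFill_flip, cornerWeight_flip]

/-- **Coin-flip covariance.** Flipping every coin turns `Bernoulli(b)` coins into
`Bernoulli(1 - b)` coins; at `b = ½` the coin law is flip-invariant. [cite: MorinduchesneKlumperPearce2023, §3.1] -/
theorem coinMeasure_map_flip (b : unitInterval) :
    (coinMeasure b).map (fun κ v => !κ v) = coinMeasure (unitInterval.symm b) := by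
  have hnot : ∀ _ : Site 2, Measurable (fun a : Bool => !a) := fun _ => Measurable.of_discrete
  have h := Measure.infinitePi_map_pi
    (μ := fun _ : Site 2 => (bernoulliMeasure true false b : Measure Bool))
    (f := fun (_ : Site 2) (a : Bool) => !a) hnot
  rw [coinMeasure, coinMeasure]
  refine h.trans ?_
  congr 1
  funext v
  rw [bernoulliMeasure, bernoulliMeasure, Measure.map_add _ _ (hnot v), Measure.map_smul,
    Measure.map_smul, Measure.map_dirac' (hnot v), Measure.map_dirac' (hnot v),
    unitInterval.symm_symm, add_comm]
  rfl

/-! ### Lattice symmetries: relabelling cells and faces -/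

/-- Membership in the image of a finite set under a bijection. [folklore] -/
private theorem mem_image_equiv {e : Site 2 ≃ Site 2} {s : Finset (Site 2)} {c : Site 2} :
    c ∈ s.image e ↔ e.symm c ∈ s := by
  constructor
  · intro h
    obtain ⟨a, ha, rfl⟩ := mem_image.1 h
    simpa using ha
  · intro h
    exact mem_image.2 ⟨_, h, e.apply_symm_apply c⟩

/-- Reindexing a sum over the subsets of `Λ.image e` as a sum over the subsets of `Λ`. [folklore] -/
private theorem sum_powerset_image (Λ : Finset (Site 2)) (e : Site 2 ≃ Site 2) {M : Type*}
    [AddCommMonoid M] (F : Finset (Site 2) → M) :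
    ∑ s ∈ (Λ.image e).powerset, F s = ∑ s ∈ Λ.powerset, F (s.image e) := by
  refine (sum_nbij' (fun s : Finset (Site 2) => s.image e) (fun s : Finset (Site 2) => s.image e.symm)
    (fun s hs => ?_) (fun s hs => ?_)
    (fun s _ => ?_) (fun s _ => ?_) (fun _ _ => rfl)).symm
  · rw [mem_powerset] at hs ⊢
    exact image_subset_image hs
  · rw [mem_powerset] at hs ⊢
    intro c hc
    obtain ⟨a, ha, rfl⟩ := mem_image.1 hc
    exact mem_image_equiv.1 (hs ha)
  · rw [image_image, Equiv.symm_comp_self, image_id]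
  · rw [image_image, Equiv.self_comp_symm, image_id]

section Relabel

/-! A **face-compatible relabelling** is a pair of bijections, `e` of the cells and `f` of the
grid vertices (faces), such that `e` maps the face of `v` onto the face of `f v`:
`hface : ∀ v, (cellFace v).image e = cellFace (f v)`.  Translations (`image_cellFace_shift`), the
quarter turn and the axis reflection of `CellGridSaddleSymmetry.lean` (`CellSymmetry.rot`,
`CellSymmetry.reflect`: `image_cellFace_rot`, `image_cellFace_reflect`) are such pairs, hence so
is every lattice isometry of `ℤ²`. -/

variable {e f : Site 2 ≃ Site 2} (hface : ∀ v, (cellFace v).image e = cellFace (f v))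
include hface

/-- The face of `f v` consists of the images of the cells of the face of `v`. [folklore] -/
theorem mem_cellFace_relabel_iff (v c : Site 2) : c ∈ cellFace (f v) ↔ e.symm c ∈ cellFace v := by
  rw [← hface, mem_image_equiv]

/-- The black count is invariant under relabelling (the colour travels with its cell). [folklore] -/
theorem blackCount_relabel (σ : Site 2 → Bool) (v : Site 2) :
    blackCount (σ ∘ e.symm) (f v) = blackCount σ v := by
  rw [blackCount_eq_sum, blackCount_eq_sum, ← hface, sum_image fun x _ y _ h => e.injective h]
  simp

/-- Odd faces are carried to odd faces. [folklore] -/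
theorem isOddFace_relabel_iff (σ : Site 2 → Bool) (v : Site 2) :
    IsOddFace (σ ∘ e.symm) (f v) ↔ IsOddFace σ v := by
  rw [IsOddFace, IsOddFace, blackCount_relabel hface]

/-- The odd-face count over the relabelled vertex set of the relabelled colouring is unchanged. [folklore] -/
theorem oddFaceCount_relabel (V : Finset (Site 2)) (σ : Site 2 → Bool) :
    oddFaceCount (V.image f) (σ ∘ e.symm) = oddFaceCount V σ := by
  rw [oddFaceCount, oddFaceCount, filter_image, card_image_of_injective _ f.injective]
  congr 1
  exact filter_congr fun v _ => isOddFace_relabel_iff hface σ v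

omit hface in
/-- Relabelling a compatible colouring: volume, boundary condition and black set are relabelled. [folklore] -/
theorem boxFill_relabel (e : Site 2 ≃ Site 2) (Λ : Finset (Site 2)) (ξ : Site 2 → Bool)
    (s : Finset (Site 2)) :
    boxFill (Λ.image e) (ξ ∘ e.symm) (s.image e) = boxFill Λ ξ s ∘ e.symm := by
  funext c
  simp only [Function.comp_apply, boxFill, mem_image_equiv]

/-- The weight of a relabelled compatible colouring. [folklore] -/
theorem cornerWeight_relabel (t : ℝ≥0) (V Λ : Finset (Site 2)) (ξ : Site 2 → Bool) (s : Finset (Site 2)) :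
    cornerWeight t (V.image f) (boxFill (Λ.image e) (ξ ∘ e.symm) (s.image e)) =
      cornerWeight t V (boxFill Λ ξ s) := by
  rw [boxFill_relabel, cornerWeight, cornerWeight, oddFaceCount_relabel hface]

/-- The vertices meeting the relabelled volume are the relabelled vertices meeting the volume. [folklore] -/
theorem verticesMeeting_image (Λ : Finset (Site 2)) :
    verticesMeeting (Λ.image e) = (verticesMeeting Λ).image f := by
  ext w
  rw [mem_verticesMeeting_iff, mem_image_equiv, mem_verticesMeeting_iff]
  have hw : w = f (f.symm w) := (f.apply_symm_apply w).symm
  constructor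
  · rintro ⟨c, hc, hcΛ⟩
    refine ⟨e.symm c, ?_, mem_image_equiv.1 hcΛ⟩
    rw [hw] at hc
    exact (mem_cellFace_relabel_iff hface _ _).1 hc
  · rintro ⟨c, hc, hcΛ⟩
    refine ⟨e c, ?_, mem_image_equiv.2 (by simpa using hcΛ)⟩
    rw [hw]
    exact (mem_cellFace_relabel_iff hface _ _).2 (by simpa using hc)

/-- The inner vertices of the relabelled volume are the relabelled inner vertices. [folklore] -/
theorem innerVertices_image (Λ : Finset (Site 2)) :
    innerVertices (Λ.image e) = (innerVertices Λ).image f := by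
  ext w
  rw [mem_innerVertices_iff, mem_image_equiv, mem_innerVertices_iff]
  have hw : w = f (f.symm w) := (f.apply_symm_apply w).symm
  rw [hw, Equiv.symm_apply_apply, ← hface]
  exact image_subset_image_iff e.injective

/-- The partition function is invariant under relabelling. [folklore] -/
theorem cornerPartitionFunction_relabel (t : ℝ≥0) (V Λ : Finset (Site 2)) (ξ : Site 2 → Bool) :
    cornerPartitionFunction t (V.image f) (Λ.image e) (ξ ∘ e.symm) = cornerPartitionFunction t V Λ ξ := by
  unfold cornerPartitionFunction
  rw [sum_powerset_image]
  exact sum_congr rfl fun s _ => cornerWeight_relabel hface t V Λ ξ s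

omit hface in
/-- Relabelling colourings (or coins) is measurable. [folklore] -/
theorem measurable_relabel (e : Site 2 ≃ Site 2) :
    Measurable fun (σ : Site 2 → Bool) => σ ∘ e.symm :=
  measurable_pi_lambda _ fun c => measurable_pi_apply (e.symm c)

/-- **Lattice covariance of the Gibbs distribution.** The image of the Gibbs distribution in `Λ`
with boundary condition `ξ` and interaction vertices `V` under the relabelling `σ ↦ σ ∘ e⁻¹` is
the Gibbs distribution in `e Λ` with boundary condition `ξ ∘ e⁻¹` and interaction vertices `f V`
(translations, rotations and reflections of `ℤ²`). [folklore] -/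
theorem cornerGibbsMeasure_map_relabel (t : ℝ≥0) (V Λ : Finset (Site 2)) (ξ : Site 2 → Bool) :
    (cornerGibbsMeasure t V Λ ξ).map (fun σ => σ ∘ e.symm) =
      cornerGibbsMeasure t (V.image f) (Λ.image e) (ξ ∘ e.symm) := by
  rw [cornerGibbsMeasure, cornerGibbsMeasure, Measure.map_smul, cornerPartitionFunction_relabel hface,
    map_finsetSum_smul_dirac _ _ _ (measurable_relabel e),
    sum_powerset_image Λ e fun s =>
      cornerWeight t (V.image f) (boxFill (Λ.image e) (ξ ∘ e.symm) s) •
        Measure.dirac (boxFill (Λ.image e) (ξ ∘ e.symm) s)]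
  refine congrArg _ (sum_congr rfl fun s _ => ?_)
  rw [cornerWeight_relabel hface, boxFill_relabel]

omit hface in
/-- **Relabelling invariance of the coin law** (reindexing an i.i.d. family,
`Measure.infinitePi_map_piCongrLeft`). [folklore] -/
theorem coinMeasure_map_relabel (b : unitInterval) (f : Site 2 ≃ Site 2) :
    (coinMeasure b).map (fun κ => κ ∘ f.symm) = coinMeasure b := by
  have h := Measure.infinitePi_map_piCongrLeft (X := fun _ : Site 2 => Bool)
    (fun _ : Site 2 => (bernoulliMeasure true false b : Measure Bool)) f
  have hcoe : ⇑(MeasurableEquiv.piCongrLeft (fun _ : Site 2 => Bool) f) =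
      fun κ : Site 2 → Bool => κ ∘ f.symm := by
    funext κ w
    rw [MeasurableEquiv.coe_piCongrLeft, Equiv.piCongrLeft_apply_eq_cast, cast_eq]
    rfl
  rw [← hcoe]
  exact h

/-- **Lattice covariance of the corner-fugacity measure** (boundary-condition version, coins
relabelled by `f`, not flipped). [folklore] -/
theorem cornerFugacityMeasure_map_relabel (t : ℝ≥0) (b : unitInterval) (Λ : Finset (Site 2))
    (ξ : Site 2 → Bool) :
    (cornerFugacityMeasure t b Λ ξ).map (Prod.map (fun σ => σ ∘ e.symm) (fun κ => κ ∘ f.symm)) =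
      cornerFugacityMeasure t b (Λ.image e) (ξ ∘ e.symm) := by
  rw [cornerFugacityMeasure, cornerFugacityMeasure,
    ← Measure.map_prod_map _ _ (measurable_relabel e) (measurable_relabel f),
    cornerGibbsMeasure_map_relabel hface, verticesMeeting_image hface, coinMeasure_map_relabel]

/-- **Lattice covariance of the free corner-fugacity measure** (coins relabelled, not flipped). [folklore] -/
theorem freeCornerFugacityMeasure_map_relabel (t : ℝ≥0) (b : unitInterval) (Λ : Finset (Site 2)) :
    (freeCornerFugacityMeasure t b Λ).map (Prod.map (fun σ => σ ∘ e.symm) (fun κ => κ ∘ f.symm)) =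
      freeCornerFugacityMeasure t b (Λ.image e) := by
  rw [freeCornerFugacityMeasure, freeCornerFugacityMeasure,
    ← Measure.map_prod_map _ _ (measurable_relabel e) (measurable_relabel f),
    cornerGibbsMeasure_map_relabel hface, innerVertices_image hface, coinMeasure_map_relabel]
  rfl

end Relabel

/-- **Translations are face-compatible:** translating cells and faces by `w`.
(Friedli–Velenik 2017, §3.1, translation invariance.) [cite: FriedliVelenik2017, §3.1] -/
theorem image_cellFace_shift (w v : Site 2) :
    (cellFace v).image (Site.shift w) = cellFace (Site.shift w v) := by
  simp only [cellFace, image_insert, image_singleton, Site.shift_apply, add_right_comm _ _ w]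

/-- **The quarter turn is face-compatible:** the face with corners `w, w + e₀, w + e₁, w + 1` is
carried by `rotCell` onto the face with lower-left cell `CellSymmetry.rot.face w = rotCell w - e₀`. [folklore] -/
theorem image_cellFace_rot (v : Site 2) :
    (cellFace v).image CellSymmetry.rot.cell = cellFace (CellSymmetry.rot.face v) := by
  change (cellFace v).image rotCell = cellFace ((rotCell.trans (Equiv.addRight (-(Pi.single 0 1 : Site 2)))) v)
  ext c
  simp only [cellFace, mem_image, mem_insert, mem_singleton, or_and_right, exists_or, exists_eq_left]
  simp only [Equiv.trans_apply, Equiv.coe_addRight, funext_iff, Fin.forall_fin_two, Pi.add_apply,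
    Pi.neg_apply, Pi.one_apply, rotCell_apply_zero, rotCell_apply_one, Pi.single_eq_same,
    Pi.single_eq_of_ne (one_ne_zero : (1 : Fin 2) ≠ 0),
    Pi.single_eq_of_ne (zero_ne_one : (0 : Fin 2) ≠ 1)]
  omega

/-- **The axis reflection is face-compatible:** `cellReflect` carries the face of `w` onto the face
with lower-left cell `CellSymmetry.reflect.face w = cellReflect w - e₁`. [folklore] -/
theorem image_cellFace_reflect (v : Site 2) :
    (cellFace v).image CellSymmetry.reflect.cell = cellFace (CellSymmetry.reflect.face v) := by
  change (cellFace v).image cellReflect =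
    cellFace ((cellReflect.trans (Equiv.addRight (-(Pi.single 1 1 : Site 2)))) v)
  ext c
  simp only [cellFace, mem_image, mem_insert, mem_singleton, or_and_right, exists_or, exists_eq_left]
  simp only [Equiv.trans_apply, Equiv.coe_addRight, funext_iff, Fin.forall_fin_two, Pi.add_apply,
    Pi.neg_apply, Pi.one_apply, cellReflect_apply_zero, cellReflect_apply_one, Pi.single_eq_same,
    Pi.single_eq_of_ne (one_ne_zero : (1 : Fin 2) ≠ 0),
    Pi.single_eq_of_ne (zero_ne_one : (0 : Fin 2) ≠ 1)]
  omega

/-! ### Covariance under the cell symmetries of `CellGridSaddleSymmetry.lean` -/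

namespace CellSymmetry

variable (s : CellSymmetry)

/-- The coin bias after transporting the coins by `s`: flipped to `1 - b` if `s` exchanges the two
diagonal directions. [folklore] -/
def biasAct (b : unitInterval) : unitInterval := cond s.flip (unitInterval.symm b) b

/-- `biasAct` is an involution. [folklore] -/
@[simp] theorem biasAct_biasAct (b : unitInterval) : s.biasAct (s.biasAct b) = b := by
  unfold biasAct; cases s.flip <;> simp

/-- The transported coins are the relabelled coins, flipped if `s.flip`. [folklore] -/
theorem coinAct_eq : s.coinAct = (fun κ v => cond s.flip (!κ v) (κ v)) ∘ fun κ : Site 2 → Bool => κ ∘ s.face.symm :=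
  rfl

/-- Flipping (or not) all coins is measurable. [folklore] -/
private theorem measurable_condFlip (c : Bool) :
    Measurable fun (κ : Site 2 → Bool) (v : Site 2) => cond c (!κ v) (κ v) := by
  cases c
  · exact measurable_id
  · exact measurable_flip

/-- The coin transport is measurable. [folklore] -/
theorem measurable_coinAct : Measurable s.coinAct := by
  rw [coinAct_eq]
  exact (measurable_condFlip s.flip).comp (measurable_relabel s.face)

/-- **The coin law is transported to the coin law with bias `biasAct b`.** [folklore] -/
theorem coinMeasure_map_coinAct (b : unitInterval) : (coinMeasure b).map s.coinAct = coinMeasure (s.biasAct b) := by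
  rw [coinAct_eq, ← Measure.map_map (measurable_condFlip s.flip) (measurable_relabel s.face),
    coinMeasure_map_relabel, biasAct]
  cases s.flip
  · exact Measure.map_id
  · exact coinMeasure_map_flip b

/-- The action on configurations is the product of the cell relabelling and the coin transport. [folklore] -/
theorem act_eq_prodMap : s.act = Prod.map (fun σ : Site 2 → Bool => σ ∘ s.cell.symm) s.coinAct := rfl

variable (hface : ∀ v, (cellFace v).image s.cell = cellFace (s.face v))
include hface

/-- **Covariance of the corner-fugacity measure under a face-compatible cell symmetry**
(boundary-condition version): `s` transports `M(t, b)` in `Λ` with boundary condition `ξ` to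
`M(t, biasAct b)` in `s Λ` with boundary condition `ξ ∘ s⁻¹`. [folklore] -/
theorem map_act_cornerFugacityMeasure (t : ℝ≥0) (b : unitInterval) (Λ : Finset (Site 2)) (ξ : Site 2 → Bool) :
    (cornerFugacityMeasure t b Λ ξ).map s.act =
      cornerFugacityMeasure t (s.biasAct b) (Λ.image s.cell) (ξ ∘ s.cell.symm) := by
  rw [act_eq_prodMap, cornerFugacityMeasure, cornerFugacityMeasure,
    ← Measure.map_prod_map _ _ (measurable_relabel s.cell) s.measurable_coinAct,
    cornerGibbsMeasure_map_relabel hface, verticesMeeting_image hface, coinMeasure_map_coinAct]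

/-- **Covariance of the free corner-fugacity measure under a face-compatible cell symmetry.** [folklore] -/
theorem map_act_freeCornerFugacityMeasure (t : ℝ≥0) (b : unitInterval) (Λ : Finset (Site 2)) :
    (freeCornerFugacityMeasure t b Λ).map s.act = freeCornerFugacityMeasure t (s.biasAct b) (Λ.image s.cell) := by
  rw [act_eq_prodMap, freeCornerFugacityMeasure, freeCornerFugacityMeasure,
    ← Measure.map_prod_map _ _ (measurable_relabel s.cell) s.measurable_coinAct,
    cornerGibbsMeasure_map_relabel hface, innerVertices_image hface, coinMeasure_map_coinAct]
  rfl

/-- Applied form: probabilities of arbitrary sets of configurations under the free measure in the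
transported volume. [folklore] -/
theorem freeCornerFugacityMeasure_image_apply (t : ℝ≥0) (b : unitInterval) (Λ : Finset (Site 2))
    {E : Set CellConfig} (hE : MeasurableSet E) :
    freeCornerFugacityMeasure t (s.biasAct b) (Λ.image s.cell) E =
      freeCornerFugacityMeasure t b Λ (s.act ⁻¹' E) := by
  rw [← s.map_act_freeCornerFugacityMeasure hface, Measure.map_apply s.measurable_act hE]

end CellSymmetry

/-- The colour swap of `CellGridSaddlePercolation.lean` (colours flipped, coins kept) transports
the corner-fugacity measure with boundary condition `ξ` to the one with boundary condition `¬ξ`. [cite: BloteNienhuis1989, §2] -/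
theorem cornerFugacityMeasure_map_swap (t : ℝ≥0) (b : unitInterval) (Λ : Finset (Site 2)) (ξ : Site 2 → Bool) :
    (cornerFugacityMeasure t b Λ ξ).map CellConfig.swap = cornerFugacityMeasure t b Λ (fun c => !ξ c) := by
  have h : CellConfig.swap = Prod.map (fun (σ : Site 2 → Bool) (c : Site 2) => !σ c) id := by
    funext ω; rfl
  rw [h, cornerFugacityMeasure, cornerFugacityMeasure,
    ← Measure.map_prod_map _ _ measurable_flip measurable_id, cornerGibbsMeasure_map_flip, Measure.map_id]

/-- Flipping all coins (colours kept) transports the free measure at bias `b` to the free measure at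
bias `1 - b`; at `b = ½` coin flips are free. [cite: MorinduchesneKlumperPearce2023, §3.1] -/
theorem freeCornerFugacityMeasure_map_flipCoins (t : ℝ≥0) (b : unitInterval) (Λ : Finset (Site 2)) :
    (freeCornerFugacityMeasure t b Λ).map (Prod.map id fun (κ : Site 2 → Bool) (v : Site 2) => !κ v) =
      freeCornerFugacityMeasure t (unitInterval.symm b) Λ := by
  rw [freeCornerFugacityMeasure, freeCornerFugacityMeasure,
    ← Measure.map_prod_map _ _ measurable_id measurable_flip, Measure.map_id, coinMeasure_map_flip]

/-! ### The box of a planar domain -/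

/-- The **box of cells of a planar domain** `Ω` at mesh `δ`: the cells `x` whose mesh point
`δ x` (`meshPoint`, the convention of `DomainDiscretisation.lean` and of `cellCrossing`) lies within
closed distance `1` of `Ω` (`Metric.cthickening 1 Ω`), as a `Finset` — finite for bounded `Ω` and
`δ > 0` (`mem_cellBox_iff`), the junk value `∅` when infinite.  A volume macroscopically larger
than `Ω` by a unit collar, containing the discrete domain `meshDomain Ω δ`
(`meshDomain_subset_cellBox`) and exactly covariant under the cell symmetries
(`cellBox_image_plane`). [folklore] -/
def cellBox (Ω : Set ℂ) (δ : ℝ) : Finset (Site 2) := by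
  classical
  exact if h : (meshVertices (Metric.cthickening 1 Ω) δ).Finite then h.toFinset else ∅

/-- For bounded `Ω` and `δ > 0` the defining set of the box is finite. [folklore] -/
theorem meshVertices_cthickening_finite {Ω : Set ℂ} {δ : ℝ} (hΩ : Bornology.IsBounded Ω) (hδ : 0 < δ) :
    (meshVertices (Metric.cthickening 1 Ω) δ).Finite :=
  meshVertices_finite hΩ.cthickening hδ

/-- Membership in the box (bounded `Ω`, `δ > 0`): the mesh point is within distance `1` of `Ω`. [folklore] -/
theorem mem_cellBox_iff {Ω : Set ℂ} {δ : ℝ} (hΩ : Bornology.IsBounded Ω) (hδ : 0 < δ) {x : Site 2} :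
    x ∈ cellBox Ω δ ↔ meshPoint δ x ∈ Metric.cthickening 1 Ω := by
  rw [cellBox, dif_pos (meshVertices_cthickening_finite hΩ hδ), Set.Finite.mem_toFinset,
    mem_meshVertices_iff]

/-- Cells whose mesh point lies in `closure Ω` belong to the box. [folklore] -/
theorem mem_cellBox_of_mem_closure {Ω : Set ℂ} {δ : ℝ} (hΩ : Bornology.IsBounded Ω) (hδ : 0 < δ)
    {x : Site 2} (hx : meshPoint δ x ∈ closure Ω) : x ∈ cellBox Ω δ :=
  (mem_cellBox_iff hΩ hδ).2 (Metric.closure_subset_cthickening 1 Ω hx)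

/-- The discrete domain `Ω_δ` of `DomainDiscretisation.lean` (the cells carrying the crossing
event) lies in the box. [folklore] -/
theorem meshDomain_subset_cellBox {Ω : Set ℂ} {δ : ℝ} (hΩ : Bornology.IsBounded Ω) (hδ : 0 < δ) :
    meshDomain Ω δ ⊆ ↑(cellBox Ω δ) := fun _ hx =>
  mem_coe.2 (mem_cellBox_of_mem_closure hΩ hδ
    (subset_closure (mem_meshVertices_iff.1 (meshDomain_subset_meshVertices Ω δ hx))))

/-- **Covariance of the box.** If a bijection `e` of the cells is induced at mesh `δ` by an
isometry `φ` of the plane (`δ (e x) = φ (δ x)`), the box of `φ Ω` is the `e`-image of the box of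
`Ω`. [folklore] -/
theorem cellBox_image_eq {Ω : Set ℂ} {δ : ℝ} (e : Site 2 ≃ Site 2) {φ : ℂ → ℂ} (hφ : Isometry φ)
    (he : ∀ x, meshPoint δ (e x) = φ (meshPoint δ x)) :
    cellBox (φ '' Ω) δ = (cellBox Ω δ).image e := by
  have key : meshVertices (Metric.cthickening 1 (φ '' Ω)) δ =
      e '' meshVertices (Metric.cthickening 1 Ω) δ := by
    ext x
    rw [mem_meshVertices_iff, Set.mem_image]
    constructor
    · intro hx
      refine ⟨e.symm x, ?_, e.apply_symm_apply x⟩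
      rw [mem_meshVertices_iff, Metric.mem_cthickening_iff]
      rw [← e.apply_symm_apply x, he, Metric.mem_cthickening_iff, Metric.infEDist_image hφ] at hx
      exact hx
    · rintro ⟨y, hy, rfl⟩
      rw [mem_meshVertices_iff, Metric.mem_cthickening_iff] at hy
      rw [he, Metric.mem_cthickening_iff, Metric.infEDist_image hφ]
      exact hy
  by_cases hfin : (meshVertices (Metric.cthickening 1 Ω) δ).Finite
  · have hfin' : (meshVertices (Metric.cthickening 1 (φ '' Ω)) δ).Finite := key ▸ hfin.image e
    rw [cellBox, dif_pos hfin', cellBox, dif_pos hfin]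
    ext x
    simp only [Set.Finite.mem_toFinset, mem_image, key, Set.mem_image]
  · have hfin' : ¬ (meshVertices (Metric.cthickening 1 (φ '' Ω)) δ).Finite := fun h => hfin <| by
      have := h.preimage (e.injective.injOn)
      rwa [key, e.injective.preimage_image] at this
    rw [cellBox, dif_neg hfin', cellBox, dif_neg hfin, image_empty]

/-- **Covariance of the box under a cell symmetry** (quarter turn, axis reflection, and their
composites): the box of `s Ω` is the `s.cell`-image of the box of `Ω`. [folklore] -/
theorem cellBox_image_plane (s : CellSymmetry) (Ω : Set ℂ) (δ : ℝ) :
    cellBox (s.plane '' Ω) δ = (cellBox Ω δ).image s.cell :=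
  cellBox_image_eq s.cell s.plane.isometry (s.meshPoint_cell δ)

/-! ### The crossing probabilities of conformal rectangles -/

/-- **The crossing probability of the corner-fugacity model** `M(t, b)`: the probability, under the
FREE corner-fugacity measure in the box `cellBox R.carrier δ` of the conformal rectangle
`R = (Ω; a, b, c, d)` at mesh `δ`, of the black crossing event `cellDomainCrossing R δ` of
`CellGridSaddleSymmetry.lean` (a path of black cells of `Ω_δ` from the discrete arc of `(ab)` to
that of `(cd)`, saddles resolved by the coins; G02 conventions).  Finite-volume convention: free
boundary condition in a unit collar around `Ω` (planner: "any reasonable convention provided exact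
`D₄`-covariance, the `u = π/3` identification and values in `[0, 1]`"). [folklore] -/
def cornerCrossingProb (t : ℝ≥0) (b : unitInterval) (R : RandomPlanarGeometry.ConformalRectangle)
    (δ : ℝ) : ℝ :=
  (freeCornerFugacityMeasure t b (cellBox R.carrier δ)).real (cellDomainCrossing R δ)

/-- **The Izergin–Korepin crossing probability** `ikCrossingProb u R δ` of the conformal rectangle
`R` at mesh `δ` for the `n = 1` dilute `A₂⁽²⁾` model at `λ = π/3`, spectral parameter `u`: the
crossing probability of `M(t(u), b(u))` (route CardyIKTransport: `P := ikCrossingProb (π/2)` in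
`AnchorByRigidity` / `IKLinearTransport`). [cite: MorinduchesneKlumperPearce2023, §3.6] -/
def ikCrossingProb (u : ℝ) (R : RandomPlanarGeometry.ConformalRectangle) (δ : ℝ) : ℝ :=
  cornerCrossingProb (ikCornerFugacity u) (ikCoinBias u) R δ

/-- Unfolding `ikCrossingProb`. [folklore] -/
theorem ikCrossingProb_eq (u : ℝ) (R : RandomPlanarGeometry.ConformalRectangle) (δ : ℝ) :
    ikCrossingProb u R δ =
      (freeIKMeasure u (cellBox R.carrier δ)).real (cellDomainCrossing R δ) :=
  rfl

/-- **(iii)** Crossing probabilities lie in `[0, 1]`. [folklore] -/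
theorem cornerCrossingProb_mem_Icc (t : ℝ≥0) (b : unitInterval)
    (R : RandomPlanarGeometry.ConformalRectangle) (δ : ℝ) :
    cornerCrossingProb t b R δ ∈ Set.Icc (0 : ℝ) 1 :=
  ⟨measureReal_nonneg, measureReal_le_one⟩

/-- **(iii)** The Izergin–Korepin crossing probabilities lie in `[0, 1]`. [folklore] -/
theorem ikCrossingProb_mem_Icc (u : ℝ) (R : RandomPlanarGeometry.ConformalRectangle) (δ : ℝ) :
    ikCrossingProb u R δ ∈ Set.Icc (0 : ℝ) 1 :=
  cornerCrossingProb_mem_Icc _ _ R δ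

/-- **Covariance of the crossing probability under a face-compatible cell symmetry:** the crossing
probability of the transported rectangle `s R` for `M(t, biasAct b)` equals that of `R` for
`M(t, b)` (the box is transported by `cellBox_image_plane`, the free measure by
`map_act_freeCornerFugacityMeasure`, the event by `preimage_act_cellCrossing`). [folklore] -/
theorem cornerCrossingProb_map_plane (s : CellSymmetry)
    (hface : ∀ v, (cellFace v).image s.cell = cellFace (s.face v)) (t : ℝ≥0) (b : unitInterval)
    (R : RandomPlanarGeometry.ConformalRectangle) (δ : ℝ) :
    cornerCrossingProb t (s.biasAct b) (R.map s.plane.toHomeomorph) δ = cornerCrossingProb t b R δ := by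
  have hcar : (R.map s.plane.toHomeomorph).carrier = s.plane '' R.carrier := by
    rw [RandomPlanarGeometry.MarkedDomain.carrier_map]; rfl
  have hev : cellDomainCrossing (R.map s.plane.toHomeomorph) δ =
      cellCrossing (s.plane '' R.carrier) δ (s.plane '' R.arc 0) (s.plane '' R.arc 2) := by
    rw [cellDomainCrossing, RandomPlanarGeometry.MarkedDomain.carrier_map,
      RandomPlanarGeometry.MarkedDomain.arc_map, RandomPlanarGeometry.MarkedDomain.arc_map]
    rfl
  rw [cornerCrossingProb, cornerCrossingProb, measureReal_def, measureReal_def, hcar, cellBox_image_plane,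
    s.freeCornerFugacityMeasure_image_apply hface _ _ _ (measurableSet_cellDomainCrossing _ _), hev,
    s.preimage_act_cellCrossing, cellDomainCrossing]

/-- Multiplication by `i` as a homeomorphism is the plane action of the quarter turn. [folklore] -/
theorem mulLeft₀_I_eq_rot_plane :
    Homeomorph.mulLeft₀ Complex.I Complex.I_ne_zero = CellSymmetry.rot.plane.toHomeomorph :=
  Homeomorph.ext fun z => by
    rw [Homeomorph.coe_mulLeft₀, LinearIsometryEquiv.coe_toHomeomorph, CellSymmetry.rot_plane_apply]

/-- The quarter turn flips the coin bias: `biasAct b = 1 - b`. [folklore] -/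
@[simp] theorem CellSymmetry.rot_biasAct (b : unitInterval) :
    CellSymmetry.rot.biasAct b = unitInterval.symm b := rfl

/-- **Quarter-turn covariance of the crossing probability** (every `t`, every `b`): turning the
rectangle by `i` about the origin amounts to replacing the coin bias `b` by `1 - b` (a quarter turn
exchanges the two diagonal pairings). [folklore] -/
theorem cornerCrossingProb_rot (t : ℝ≥0) (b : unitInterval) (R : RandomPlanarGeometry.ConformalRectangle)
    (δ : ℝ) :
    cornerCrossingProb t (unitInterval.symm b) (R.map (Homeomorph.mulLeft₀ Complex.I Complex.I_ne_zero)) δ =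
      cornerCrossingProb t b R δ := by
  rw [mulLeft₀_I_eq_rot_plane, ← CellSymmetry.rot_biasAct]
  exact cornerCrossingProb_map_plane CellSymmetry.rot image_cellFace_rot t b R δ

/-- At the isotropic point the coins are fair, so flipping the bias does nothing. [cite: MorinduchesneKlumperPearce2023, §3.6] -/
@[simp] theorem symm_ikCoinBias_pi_div_two :
    unitInterval.symm (ikCoinBias (Real.pi / 2)) = ikCoinBias (Real.pi / 2) :=
  Subtype.ext (by rw [unitInterval.coe_symm_eq, coe_ikCoinBias_pi_div_two]; norm_num)

/-- **(i) Exact `D₄`-covariance of the isotropic Izergin–Korepin crossing probability, quarter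
turn:** `ikCrossingProb (π/2) (i·R) δ = ikCrossingProb (π/2) R δ` for every conformal rectangle `R`
and every mesh `δ` — hypothesis (a) of `AnchorByRigidity` (route CardyIKTransport) holds with
equality before any limit. [cite: MorinduchesneKlumperPearce2023, §3.6] -/
theorem ikCrossingProb_pi_div_two_rot (R : RandomPlanarGeometry.ConformalRectangle) (δ : ℝ) :
    ikCrossingProb (Real.pi / 2) (R.map (Homeomorph.mulLeft₀ Complex.I Complex.I_ne_zero)) δ =
      ikCrossingProb (Real.pi / 2) R δ := by
  rw [ikCrossingProb, ikCrossingProb]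
  conv_lhs => rw [← symm_ikCoinBias_pi_div_two]
  exact cornerCrossingProb_rot _ _ R δ

/-- The axis reflection flips the coin bias: `biasAct b = 1 - b`. [folklore] -/
@[simp] theorem CellSymmetry.reflect_biasAct (b : unitInterval) :
    CellSymmetry.reflect.biasAct b = unitInterval.symm b := rfl

/-- **Reflection covariance of the crossing probability** (every `t`, every `b`): reflecting the
rectangle in the real axis amounts to replacing `b` by `1 - b`. [folklore] -/
theorem cornerCrossingProb_reflect (t : ℝ≥0) (b : unitInterval)
    (R : RandomPlanarGeometry.ConformalRectangle) (δ : ℝ) :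
    cornerCrossingProb t (unitInterval.symm b) (R.map CellSymmetry.reflect.plane.toHomeomorph) δ =
      cornerCrossingProb t b R δ := by
  rw [← CellSymmetry.reflect_biasAct]
  exact cornerCrossingProb_map_plane CellSymmetry.reflect image_cellFace_reflect t b R δ

/-- **(i) Exact `D₄`-covariance of the isotropic Izergin–Korepin crossing probability, reflection
in the real axis** (with the quarter turn this generates `D₄`). [cite: MorinduchesneKlumperPearce2023, §3.6] -/
theorem ikCrossingProb_pi_div_two_reflect (R : RandomPlanarGeometry.ConformalRectangle) (δ : ℝ) :
    ikCrossingProb (Real.pi / 2) (R.map CellSymmetry.reflect.plane.toHomeomorph) δ =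
      ikCrossingProb (Real.pi / 2) R δ := by
  rw [ikCrossingProb, ikCrossingProb]
  conv_lhs => rw [← symm_ikCoinBias_pi_div_two]
  exact cornerCrossingProb_reflect _ _ R δ

/-- **(ii) The `u = π/3` member:** the IK crossing probability at `u = π/3` is the probability of
the cell crossing event under the uniform (i.i.d. fair) colouring of the box, white outside, with
all coins `true` — site percolation at `p = ½` on the triangulation `cellGraph (fun _ => true)`,
which `cellGraphTrueIso` (`CellGridSaddlePercolation.lean`) identifies with the triangular lattice
drawn with the NE–SW diagonal; the comparison with `triDomainCrossingProb` of the sheared domain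
(different discretisations near `∂Ω`) is left to the route (item r2), as in the companion file. [cite: MorinduchesneKlumperPearce2023, §3.6] -/
theorem ikCrossingProb_pi_div_three (R : RandomPlanarGeometry.ConformalRectangle) (δ : ℝ) :
    ikCrossingProb (Real.pi / 3) R δ =
      ((cornerGibbsMeasure 1 (innerVertices (cellBox R.carrier δ)) (cellBox R.carrier δ) (fun _ => false)).prod
        (Measure.dirac fun _ : Site 2 => true)).real (cellDomainCrossing R δ) := by
  rw [ikCrossingProb_eq, freeIKMeasure_pi_div_three]

end Literature.Probability.LatticeModels
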